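import Mathlib.MeasureTheory.Integral.RieszMarkovKakutani.Real
import Mathlib.MeasureTheory.Integral.Prod
import Literature.MeasureTheory.Group.QuotientAveraging
import HarnessLib

/-!
# Weil's invariant measure on `G ⧸ H` (unimodular case)
(A. Weil, *L'intégration dans les groupes topologiques* (1940), §9; Loomis, *An Introduction to
Abstract Harmonic Analysis* (1953), §33C–§33D)

Let `G` be a second countable locally compact Hausdorff group, `μ` a Haar measure on `G` which is
also RIGHT invariant (`G` unimodular), and `H ≤ G` a closed subgroup whose Haar measures are
invariant under `h ↦ h⁻¹` (`H` unimodular).  Then the homogeneous space `G ⧸ H` of left cosets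
carries a `G`-invariant regular Borel measure, finite on compact sets and positive on non-empty open
sets (`exists_smulInvariantMeasure_quotient`) — Weil's criterion `Δ_G|_H = Δ_H` for the existence of
an invariant quotient measure (Loomis §33D, Theorem) in the special case where both modular
functions are trivial on `H`.

Construction (Loomis §33): with the averaging map `f ↦ f♭` of `QuotientAveraging` (onto
`C_c(G ⧸ H)`), `∫_G f dμ` only depends on `f♭` (`integral_eq_of_average_eq`, through the symmetry
`∫ f · φ♭ = ∫ φ · f♭` — `integral_mul_average_comm`: Fubini, `x ↦ x h⁻¹` by right invariance of
`μ`, `h ↦ h⁻¹` by inversion invariance on `H`); so `Λ(f♭) := ∫_G f dμ` is a positive linear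
functional on `C_c(G ⧸ H)` (`weilFunctional`), represented by a regular measure (Mathlib
`RealRMK.rieszMeasure`; `weilMeasure`, `integral_weilMeasure_averageCc` = Weil's formula on
`C_c(G)`), which is `G`-invariant because `Λ` is (`weilFunctional_translate`, uniqueness of the
representing measure `Measure.ext_of_integral_eq_on_compactlySupported`) and charges open sets
(a cut-off at a point has a non-negative non-zero lift).

## Mathlib search

Riesz–Markov–Kakutani (`RealRMK.rieszMeasure`, `integral_rieszMeasure`, `regular_rieszMeasure`),
Fubini (`integral_integral_swap`), `integral_mul_right_eq_self`, `integral_inv_eq_self`,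
`Measure.Regular.map` — all used; no quotient measures for non-discrete closed subgroups in Mathlib
(`rg "G ⧸" Mathlib/MeasureTheory/Measure/Haar`: only `Haar/Quotient.lean`, countable `Γ`).

## Deliberately NOT here

-- TODO(general form): the relatively invariant case `D = Δ_G/Δ_H` (Loomis §33D in full),
uniqueness of the invariant measure up to a scalar, and Weil's formula for all `f ∈ L¹(G)`.
-/

noncomputable section

open MeasureTheory Measure Set Filter Topology Function CompactlySupported
open scoped Pointwise

namespace Literature.MeasureTheory.Group

namespace WeilQuotient

variable {G : Type*} [Group G] [TopologicalSpace G] [IsTopologicalGroup G] [LocallyCompactSpace G]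
  {H : Subgroup G} [MeasurableSpace ↥H] [BorelSpace ↥H] (hH : IsClosed (H : Set G))

/-! ### The integral only depends on the average (unimodular case) -/

section Integral

variable [T2Space G] [SecondCountableTopology G] [MeasurableSpace G] [BorelSpace G]
  (μ : Measure G) [IsHaarMeasure μ] [μ.IsMulRightInvariant]

omit [μ.IsMulRightInvariant] in
/-- The two-variable integrand `(x, h) ↦ f(x) φ(x h)` is integrable on `G × H` for `f, φ ∈ C_c(G)`:
continuous, supported in the compact `tsupport f × {h | h ∈ (tsupport f)⁻¹ tsupport φ}`. [folklore] -/
theorem integrable_pair (f φ : C_c(G, ℝ)) :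
    Integrable (fun p : G × ↥H => f p.1 * φ (p.1 * p.2)) (μ.prod (haarSub hH)) := by
  haveI : LocallyCompactSpace ↥H := hH.locallyCompactSpace
  haveI : SecondCountableTopology ↥H := TopologicalSpace.Subtype.secondCountableTopology (H : Set G)
  refine Continuous.integrable_of_hasCompactSupport ?_ ?_
  · exact (f.continuous.comp continuous_fst).mul
      (φ.continuous.comp (continuous_fst.mul (continuous_subtype_val.comp continuous_snd)))
  · refine HasCompactSupport.intro'
      (f.hasCompactSupport.prod (isCompact_window hH f.hasCompactSupport φ.hasCompactSupport))
      ((isClosed_tsupport _).prod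
        (((f.hasCompactSupport.inv.mul φ.hasCompactSupport).isClosed).preimage
          continuous_subtype_val)) ?_
    rintro ⟨x, h⟩ hxh
    rw [Set.mem_prod, not_and_or] at hxh
    rcases hxh with hx | hh
    · simp [image_eq_zero_of_notMem_tsupport hx]
    · change f x * φ (x * h) = 0
      by_cases hx : x ∈ tsupport (f : G → ℝ)
      · rw [apply_mul_eq_zero_of_not_mem_window (subset_refl _) hx hh, mul_zero]
      · rw [image_eq_zero_of_notMem_tsupport hx, zero_mul]

/-- **Symmetry of the pairing** `∫_G f · φ♭ dμ = ∫_G φ · f♭ dμ` for `f, φ ∈ C_c(G)`, when `μ` is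
right invariant and the Haar measure of `H` is inversion invariant (Fubini, `x ↦ x h⁻¹`, `h ↦ h⁻¹`;
Loomis 1953, §33C–§33D with `Δ = δ = 1`). [folklore] -/
theorem integral_mul_average_comm [(haarSub hH).IsInvInvariant] (f φ : C_c(G, ℝ)) :
    ∫ x, f x * average hH φ x ∂μ = ∫ x, φ x * average hH f x ∂μ := by
  haveI : LocallyCompactSpace ↥H := hH.locallyCompactSpace
  haveI : SecondCountableTopology ↥H := TopologicalSpace.Subtype.secondCountableTopology (H : Set G)
  -- unfold both averages into double integrals
  have hL : ∀ x, f x * average hH φ x = ∫ h : ↥H, f x * φ (x * h) ∂haarSub hH := fun x => by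
    unfold average; rw [integral_const_mul]
  have hR : ∀ x, φ x * average hH f x = ∫ h : ↥H, φ x * f (x * h) ∂haarSub hH := fun x => by
    unfold average; rw [integral_const_mul]
  simp_rw [hL, hR]
  -- Fubini on the left, substitute `x ↦ x h⁻¹`, invert `h`, Fubini back
  rw [integral_integral_swap (integrable_pair hH μ f φ)]
  have h1 : ∀ h : ↥H, ∫ x, f x * φ (x * h) ∂μ = ∫ x, f (x * (h : G)⁻¹) * φ x ∂μ := by
    intro h
    have := integral_mul_right_eq_self (μ := μ) (fun x => f (x * (h : G)⁻¹) * φ x) (h : G)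
    simp only [mul_assoc, mul_inv_cancel, mul_one] at this
    -- `this : ∫ x, f x * φ (x * h) ∂μ = ∫ x, f (x * h⁻¹) * φ x ∂μ` up to `mul_assoc`
    simpa [mul_assoc] using this
  simp_rw [h1]
  have h2 : ∫ h : ↥H, ∫ x, f (x * (h : G)⁻¹) * φ x ∂μ ∂haarSub hH =
      ∫ h : ↥H, ∫ x, f (x * (h : G)) * φ x ∂μ ∂haarSub hH := by
    have := integral_inv_eq_self (fun h : ↥H => ∫ x, f (x * (h : G)) * φ x ∂μ) (haarSub hH)
    simpa only [Subgroup.coe_inv] using this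
  rw [h2]
  have hint : Integrable (fun p : G × ↥H => f (p.1 * p.2) * φ p.1) (μ.prod (haarSub hH)) := by
    refine (integrable_pair hH μ φ f).congr (Eventually.of_forall fun p => ?_)
    change φ p.1 * f (p.1 * p.2) = f (p.1 * p.2) * φ p.1
    rw [mul_comm]
  rw [← integral_integral_swap hint]
  refine integral_congr_ae (Eventually.of_forall fun x => ?_)
  refine integral_congr_ae (Eventually.of_forall fun h => ?_)
  change f (x * h) * φ x = φ x * f (x * h)
  rw [mul_comm]

variable [IsClosed (H : Set G)]

/-- **`∫_G f dμ` only depends on `f♭`** (Loomis 1953, §33D): lift a cut-off `Φ₀ = 1` on the image of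
both supports to `φ` with `φ♭ = Φ₀ ∘ mk`; then `∫ fᵢ = ∫ fᵢ φ♭ = ∫ φ fᵢ♭`. [folklore] -/
theorem integral_eq_of_average_eq [(haarSub hH).IsInvInvariant] (f₁ f₂ : C_c(G, ℝ))
    (h : average hH f₁ = average hH f₂) : ∫ x, f₁ x ∂μ = ∫ x, f₂ x ∂μ := by
  -- the cut-off on `G ⧸ H`
  set K : Set (G ⧸ H) := QuotientGroup.mk '' (tsupport (f₁ : G → ℝ) ∪ tsupport (f₂ : G → ℝ))
    with hK
  have hKc : IsCompact K := (f₁.hasCompactSupport.union f₂.hasCompactSupport).image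
    QuotientGroup.continuous_mk
  obtain ⟨Φ₀, hΦ₀K, -, hΦ₀s, hΦ₀01⟩ := exists_continuous_one_zero_of_isCompact hKc isClosed_empty
    (disjoint_empty K)
  obtain ⟨φ, hφ, -⟩ := exists_lift hH ⟨Φ₀, hΦ₀s⟩
  have hφav : ∀ x : G, (x : G ⧸ H) ∈ K → average hH φ x = 1 := by
    intro x hx
    have := congrArg (fun Ψ : C_c(G ⧸ H, ℝ) => Ψ (x : G ⧸ H)) hφ
    simp only [averageCc_mk] at this
    rw [this]
    exact hΦ₀K hx
  have hmul : ∀ (g : C_c(G, ℝ)), tsupport (g : G → ℝ) ⊆ tsupport (f₁ : G → ℝ) ∪ tsupport (f₂ : G → ℝ) →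
      ∫ x, g x ∂μ = ∫ x, g x * average hH φ x ∂μ := by
    intro g hg
    refine integral_congr_ae (Eventually.of_forall fun x => ?_)
    change g x = g x * average hH φ x
    by_cases hx : x ∈ tsupport (g : G → ℝ)
    · rw [hφav x ⟨x, hg hx, rfl⟩, mul_one]
    · rw [image_eq_zero_of_notMem_tsupport hx, zero_mul]
  rw [hmul f₁ subset_union_left, hmul f₂ subset_union_right,
    integral_mul_average_comm hH μ f₁ φ, integral_mul_average_comm hH μ f₂ φ, h]

end Integral


/-! ### The functional `Λ(Φ) = ∫_G f dμ` for any lift `f♭ = Φ`, and its Riesz measure -/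

section Functional

variable [T2Space G] [SecondCountableTopology G] [MeasurableSpace G] [BorelSpace G]
  [IsClosed (H : Set G)] (μ : Measure G) [IsHaarMeasure μ] [μ.IsMulRightInvariant]
  [(haarSub hH).IsInvInvariant]

/-- A chosen lift `f` of `Φ` (`f♭ = Φ`, non-negative if `Φ` is). [folklore] -/
def lift (Φ : C_c(G ⧸ H, ℝ)) : C_c(G, ℝ) :=
  Classical.choose (exists_lift hH Φ)

omit [MeasurableSpace G] [BorelSpace G] [(haarSub hH).IsInvInvariant] in
/-- `(lift Φ)♭ = Φ`. [folklore] -/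
theorem averageCc_lift (Φ : C_c(G ⧸ H, ℝ)) : averageCc hH (lift hH Φ) = Φ :=
  (Classical.choose_spec (exists_lift hH Φ)).1

omit [MeasurableSpace G] [BorelSpace G] [(haarSub hH).IsInvInvariant] in
/-- `(lift Φ)♭ = Φ`, pointwise on `G`. [folklore] -/
theorem average_lift (Φ : C_c(G ⧸ H, ℝ)) (x : G) : average hH (lift hH Φ) x = Φ (x : G ⧸ H) := by
  have := congrArg (fun Ψ : C_c(G ⧸ H, ℝ) => Ψ (x : G ⧸ H)) (averageCc_lift hH Φ)
  simpa only [averageCc_mk] using this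

omit [MeasurableSpace G] [BorelSpace G] [(haarSub hH).IsInvInvariant] in
/-- The lift of a non-negative function is non-negative. [folklore] -/
theorem lift_nonneg {Φ : C_c(G ⧸ H, ℝ)} (hΦ : ∀ q, 0 ≤ Φ q) (x : G) : 0 ≤ lift hH Φ x :=
  (Classical.choose_spec (exists_lift hH Φ)).2 hΦ x

/-- **The Weil functional** `Λ(Φ) = ∫_G (lift Φ) dμ` on `C_c(G ⧸ H)`: well defined
(`integral_eq_of_average_eq`), linear and positive. [folklore] -/
def weilFunctional : C_c(G ⧸ H, ℝ) →ₚ[ℝ] ℝ :=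
  PositiveLinearMap.mk₀
    { toFun := fun Φ => ∫ x, lift hH Φ x ∂μ
      map_add' := fun Φ Ψ => by
        have hav : average hH (lift hH (Φ + Ψ)) = average hH ((lift hH Φ + lift hH Ψ : C_c(G, ℝ))) := by
          funext x
          rw [average_lift]
          change Φ x + Ψ x = average hH ((lift hH Φ : G → ℝ) + (lift hH Ψ : G → ℝ)) x
          have h1 : average hH ((lift hH Φ : G → ℝ) + (lift hH Ψ : G → ℝ)) x =
              average hH (lift hH Φ) x + average hH (lift hH Ψ) x :=
            average_add hH (lift hH Φ).continuous (lift hH Φ).hasCompactSupport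
              (lift hH Ψ).continuous (lift hH Ψ).hasCompactSupport x
          rw [h1, average_lift, average_lift]
        rw [integral_eq_of_average_eq hH μ _ _ hav]
        change ∫ x, (lift hH Φ x + lift hH Ψ x) ∂μ = _
        exact integral_add (lift hH Φ).integrable (lift hH Ψ).integrable
      map_smul' := fun c Φ => by
        have hav : average hH (lift hH (c • Φ)) = average hH ((c • lift hH Φ : C_c(G, ℝ))) := by
          funext x
          rw [average_lift]
          change c * Φ x = average hH (c • (lift hH Φ : G → ℝ)) x
          rw [average_smul, average_lift]
        rw [integral_eq_of_average_eq hH μ _ _ hav]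
        change ∫ x, c • lift hH Φ x ∂μ = _
        rw [integral_smul]
        rfl }
    fun Φ hΦ => integral_nonneg fun x => lift_nonneg hH (fun q => hΦ q) x

/-- `Λ Φ = ∫_G lift Φ dμ` (definitional). [folklore] -/
theorem weilFunctional_apply (Φ : C_c(G ⧸ H, ℝ)) :
    weilFunctional hH μ Φ = ∫ x, lift hH Φ x ∂μ := rfl

/-- **`Λ(f♭) = ∫_G f dμ`** for every `f ∈ C_c(G)`. [folklore] -/
theorem weilFunctional_averageCc (f : C_c(G, ℝ)) :
    weilFunctional hH μ (averageCc hH f) = ∫ x, f x ∂μ := by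
  rw [weilFunctional_apply]
  refine integral_eq_of_average_eq hH μ _ _ (funext fun x => ?_)
  rw [average_lift, averageCc_mk]

/-- The translate `Φ(g₀ • ·)` of `Φ ∈ C_c(G ⧸ H)`. [folklore] -/
def translate (g₀ : G) (Φ : C_c(G ⧸ H, ℝ)) : C_c(G ⧸ H, ℝ) where
  toFun q := Φ (g₀ • q)
  continuous_toFun := Φ.continuous.comp (continuous_const_smul g₀)
  hasCompactSupport' := Φ.hasCompactSupport.comp_homeomorph (Homeomorph.smul g₀)

omit [LocallyCompactSpace G] [MeasurableSpace ↥H] [BorelSpace ↥H] [T2Space G]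
  [SecondCountableTopology G] [MeasurableSpace G] [BorelSpace G] [IsClosed (H : Set G)] in
/-- `translate g₀ Φ q = Φ (g₀ • q)` (definitional). [folklore] -/
@[simp] theorem translate_apply (g₀ : G) (Φ : C_c(G ⧸ H, ℝ)) (q : G ⧸ H) :
    translate g₀ Φ q = Φ (g₀ • q) := rfl

/-- The left translate `f(g₀ ·)` of `f ∈ C_c(G)`. [folklore] -/
def translateG (g₀ : G) (f : C_c(G, ℝ)) : C_c(G, ℝ) where
  toFun x := f (g₀ * x)
  continuous_toFun := f.continuous.comp (continuous_const.mul continuous_id)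
  hasCompactSupport' := f.hasCompactSupport.comp_homeomorph (Homeomorph.mulLeft g₀)

omit [LocallyCompactSpace G] [MeasurableSpace ↥H] [BorelSpace ↥H] [T2Space G]
  [SecondCountableTopology G] [MeasurableSpace G] [BorelSpace G] [IsClosed (H : Set G)] in
/-- `translateG g₀ f x = f (g₀ x)` (definitional). [folklore] -/
@[simp] theorem translateG_apply (g₀ : G) (f : C_c(G, ℝ)) (x : G) : translateG g₀ f x = f (g₀ * x) :=
  rfl

/-- **`Λ` is `G`-invariant**: `Λ(Φ(g₀ ·)) = Λ(Φ)` (a lift of `Φ(g₀ ·)` is `(lift Φ)(g₀ ·)`, and `μ` is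
left invariant). [folklore] -/
theorem weilFunctional_translate (g₀ : G) (Φ : C_c(G ⧸ H, ℝ)) :
    weilFunctional hH μ (translate g₀ Φ) = weilFunctional hH μ Φ := by
  rw [weilFunctional_apply, weilFunctional_apply]
  have hav : average hH (lift hH (translate g₀ Φ)) = average hH (translateG g₀ (lift hH Φ)) := by
    funext x
    rw [average_lift, translate_apply]
    change Φ (g₀ • (x : G ⧸ H)) = average hH (fun y => lift hH Φ (g₀ * y)) x
    rw [average_comp_mul_left, average_lift]
    rfl
  rw [integral_eq_of_average_eq hH μ _ _ hav]
  change ∫ x, lift hH Φ (g₀ * x) ∂μ = _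
  exact integral_mul_left_eq_self (fun x => lift hH Φ x) g₀

variable [MeasurableSpace (G ⧸ H)] [BorelSpace (G ⧸ H)]

/-- **Weil's quotient measure**: the Riesz–Markov–Kakutani measure of `Λ`. [folklore] -/
def weilMeasure : Measure (G ⧸ H) :=
  RealRMK.rieszMeasure (weilFunctional hH μ)

/-- Weil's measure is regular. [folklore] -/
instance regular_weilMeasure : (weilMeasure hH μ).Regular := by
  unfold weilMeasure
  infer_instance

/-- `∫ Φ dν = Λ Φ` (Riesz–Markov–Kakutani). [folklore] -/
theorem integral_weilMeasure (Φ : C_c(G ⧸ H, ℝ)) :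
    ∫ q, Φ q ∂weilMeasure hH μ = ∫ x, lift hH Φ x ∂μ := by
  unfold weilMeasure
  rw [RealRMK.integral_rieszMeasure]
  rfl

/-- **Weil's formula on `C_c(G)`**: `∫_{G/H} f♭ dν = ∫_G f dμ`. [folklore] -/
theorem integral_weilMeasure_averageCc (f : C_c(G, ℝ)) :
    ∫ q, averageCc hH f q ∂weilMeasure hH μ = ∫ x, f x ∂μ := by
  rw [integral_weilMeasure]
  exact weilFunctional_averageCc hH μ f

/-- **Weil's measure is `G`-invariant.** [folklore] -/
theorem map_smul_weilMeasure (g₀ : G) :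
    Measure.map (g₀ • ·) (weilMeasure hH μ) = weilMeasure hH μ := by
  haveI : (Measure.map (g₀ • ·) (weilMeasure hH μ)).Regular :=
    Measure.Regular.map (Homeomorph.smul g₀)
  refine Measure.ext_of_integral_eq_on_compactlySupported fun Φ => ?_
  rw [show (∫ q, Φ q ∂Measure.map (g₀ • ·) (weilMeasure hH μ)) = ∫ q, Φ (g₀ • q) ∂weilMeasure hH μ from
    integral_map (measurable_const_smul g₀).aemeasurable Φ.continuous.aestronglyMeasurable]
  change ∫ q, translate g₀ Φ q ∂weilMeasure hH μ = _
  rw [integral_weilMeasure, integral_weilMeasure, ← weilFunctional_apply, ← weilFunctional_apply,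
    weilFunctional_translate]

/-- **Weil's measure is `G`-invariant** (`SMulInvariantMeasure` form). [folklore] -/
instance smulInvariantMeasure_weilMeasure :
    SMulInvariantMeasure G (G ⧸ H) (weilMeasure hH μ) := by
  refine ⟨fun g₀ A hA => ?_⟩
  conv_rhs => rw [← map_smul_weilMeasure hH μ g₀]
  rw [Measure.map_apply (measurable_const_smul g₀) hA]

/-- **Weil's measure charges non-empty open sets**: a cut-off `Φ` at `q₀ ∈ U` has `∫ Φ dν = ∫ lift Φ dμ > 0`.
[folklore] -/
instance isOpenPosMeasure_weilMeasure : (weilMeasure hH μ).IsOpenPosMeasure := by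
  refine ⟨fun U hU hne => ?_⟩
  obtain ⟨q₀, hq₀⟩ := hne
  obtain ⟨Φ, hΦ1, hΦ0, hΦs, hΦ01⟩ := exists_continuous_one_zero_of_isCompact
    (isCompact_singleton (x := q₀)) hU.isClosed_compl
    (disjoint_singleton_left.2 fun h => h hq₀)
  set Φc : C_c(G ⧸ H, ℝ) := ⟨Φ, hΦs⟩ with hΦc
  have hpos : 0 < ∫ q, Φc q ∂weilMeasure hH μ := by
    rw [integral_weilMeasure]
    obtain ⟨x₀, hx₀⟩ := Quotient.exists_rep q₀
    have hav : average hH (lift hH Φc) x₀ ≠ 0 := by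
      rw [average_lift]
      change Φ (Quotient.mk _ x₀ : G ⧸ H) ≠ 0
      rw [hx₀, hΦ1 rfl]
      exact one_ne_zero
    obtain ⟨h, hh⟩ := exists_apply_mul_ne_zero_of_average_ne_zero hH hav
    exact Continuous.integral_pos_of_hasCompactSupport_nonneg_nonzero (lift hH Φc).continuous
      (lift hH Φc).hasCompactSupport (fun x => lift_nonneg hH (fun q => (hΦ01 q).1) x) hh
  intro hU0
  have hzero : ∫ q, Φc q ∂weilMeasure hH μ = 0 := by
    refine integral_eq_zero_of_ae ?_
    have : ∀ᵐ q ∂weilMeasure hH μ, q ∉ U := by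
      rw [ae_iff]
      simpa using hU0
    refine this.mono fun q hq => ?_
    exact hΦ0 hq
  exact hpos.ne' hzero

end Functional

/-! ### Main statement -/

/-- **Weil's invariant quotient measure (unimodular case).**  Let `G` be a second countable locally
compact Hausdorff group with a right-invariant Haar measure (`G` unimodular), `H ≤ G` a closed
subgroup whose Haar measures are inversion invariant (`H` unimodular).  Then `G ⧸ H` carries a
`G`-invariant Borel measure, finite on compact sets and positive on non-empty open sets — the
Riesz measure of `Φ ↦ ∫_G f dμ` (`f♭ = Φ`).  (Weil 1940, §9; Loomis 1953, §33D with modulus `1`: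
the criterion `Δ_G|_H = Δ_H` in the special case where both are trivial.)
[cite: Loomis1953, §33D Theorem] -/
theorem exists_smulInvariantMeasure_quotient [T2Space G] [SecondCountableTopology G]
    [MeasurableSpace G] [BorelSpace G] [MeasurableSpace (G ⧸ H)] [BorelSpace (G ⧸ H)]
    (hH : IsClosed (H : Set G))
    (hHinv : ∀ (ν : Measure ↥H), ν.IsHaarMeasure → ν.IsInvInvariant)
    (μ : Measure G) [IsHaarMeasure μ] [μ.IsMulRightInvariant] :
    ∃ ν : Measure (G ⧸ H), SMulInvariantMeasure G (G ⧸ H) ν ∧ IsFiniteMeasureOnCompacts ν ∧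
      ν.IsOpenPosMeasure := by
  haveI : IsClosed (H : Set G) := hH
  haveI : (haarSub hH).IsInvInvariant := hHinv _ inferInstance
  exact ⟨weilMeasure hH μ, inferInstance, inferInstance, inferInstance⟩

end WeilQuotient

end Literature.MeasureTheory.Group

end
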